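import Summits.QuantumFields.BalabanUV.Beta.D1BFx.RestKernelWords

/-!
# `BalabanUV.Beta.D1BFx.RestKernelSlotGlue` — road «BF-x» for binder row D1, slot (K): **«SLOT GLUE» — THE `Sum.elim` OF TWO (K)-SLOT MEMBER
# FAMILIES CARRIES THE END's ROWS AND ADDS THE POINTWISE SUMS AND THE `hU₁` FRAGMENTS** — the one generic operator the (K6c) `Rk := Sum.elim` assembly over
# LANES iterates (OWNER W-d1p2-g18-2: «the (K6c) assembly will be ONE `Sum.elim` over LANES, and a lane that arrives as one member with its n-free `hU₁`
# fragment and its pointwise sum is exactly the unit the assembly wants»): for member families `R₁ : υ₁ → ℕ → Fin 4 → Fin 4 → Site 4 → ℝ`, `R₂ : υ₂ → …`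
# (e.g. «SANDWICH SLOT PACK» `RkSand` p324769, «GHOST SLOT PACK» `RkGhost` p320733, «BLOCK SLOT PACK» `RkBlk`), the glued family `Sum.elim R₁ R₂ : υ₁ ⊕ υ₂ → …`
# has (i) pointwise sum = sum of the two, (ii) `hMR`, (iii) `hRu` with `Ru := Sum.elim Ru₁ Ru₂`, `CU′ := Sum.elim CU′₁ CU′₂`, (iv) `hU` likewise, (v) `Σ CU′ = Σ CU′₁ + Σ CU′₂`.

HONEST DEPENDENCY (cell records, verbatim): «continuum YM on T⁴ ⇐ BetaPertH ∧ nine spine estimates (0/9 proved); BetaPertH ⇐ (D1) ∧ (D4) ∧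
CAP+tail; G-an2-4 gates asym, D1 and NE2/3/4.»  HONEST FRAMING (cell contract, verbatim): «discharging `BetaPertH` makes Bałaban's UV stability
UNCONDITIONAL — a real constructive-QFT result; it is NOT the continuum limit and NOT the Clay problem.»  THIS MODULE DISCHARGES NOTHING of the
wall: [folklore] `Sum.elim` ∕ `Fintype.sum_sum_type` bookkeeping over ABSTRACT member families; no road object, no hypothesis of Bałaban's, no
definition, no `def … : Prop`, nothing cited, 0 sorry.  0 root-level binders of row D1 discharged (hW ∕ hR-sockets ∕ hSX-socket ∕ D1Tel ∕ D1Rep — 0);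
(K) NOT closed; NOT D1, NOT `BetaPertH`, NOT continuum, NOT Clay.

ABSOLUTE RULE (cell charter, verbatim): «No internally-minted statement may enter as a cited fact. Every hypothesis is either kernel-proved in
this package or a verbatim quotation of a PUBLISHED theorem with page reference. The manuscript(s) under audit are NOT citable for their own
disputed steps — they are the thing under adjudication; programme-internal (2001/route/tribunal) claims are never citable.»

THE SHAPES (the (K1) END `RoadEndBFxDictPointwiseS.hdict_of_pointwise`, `Rk : υ → ℕ → Fin 4 → Fin 4 → Site 4 → ℝ`): `hMR : ∀ u m, 1 ≤ m → AbsMoment₂ (Rk u (Lc^m) μ ν)`;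
`hRu : ∀ u m, 1 ≤ m → |secondMoment (Rk u (Lc^m)) μ ν − Ru u (Lc^m)| ≤ CU′ u`; `hU₁ : Σ_u CU′ u ≤ U₁`; `hU : ∀ n, 2 ≤ n → ∀ u, |Ru u n| ≤ CU u`.

CONTENT (all [folklore], abstract `υ₁ υ₂`): `sum_elim_pointwise`; `hMR_elim`; `hRu_elim`; `hU_elim`; `unit_row_elim`; `sum_elim_const` (`Σ_{υ₁ ⊕ υ₂} Sum.elim C₁ C₂ = Σ C₁ + Σ C₂`);
`hU₁_elim` (fragments add).  NOT HERE: any member family, `hptw`, any statement about `TshotOf`.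
Unit `b2b-balaban-beta-d1-formalise-leaf-01` (gen 23), D1 formalisation swarm leaf prover 01, road «BF-x»; INTENT «SLOT GLUE» (journal).
-/

noncomputable section

open Finset
open scoped BigOperators
open Literature.MathematicalPhysics.QuantumFieldTheory.Balaban1983to89
open Literature.MathematicalPhysics.QuantumFieldTheory.Balaban1983to89.Beta
open ExpKernelCalculus (Site)
open DecimatedMomentSummable (AbsMoment₂)

namespace Summit.QuantumFields.BalabanUV.Beta.D1BFx.RestKernelSlotGlue

variable {υ₁ υ₂ : Type*}

/-! ## §1 The pointwise sum of a glued family -/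

/-- [folklore] **THE GLUED FAMILY's CONTRIBUTION TO `Σ_u Rk u n μ ν z` IS THE SUM OF THE TWO LANES'** (`Fintype.sum_sum_type`). -/
theorem sum_elim_pointwise [Fintype υ₁] [Fintype υ₂] (R₁ : υ₁ → ℕ → Fin 4 → Fin 4 → Site 4 → ℝ) (R₂ : υ₂ → ℕ → Fin 4 → Fin 4 → Site 4 → ℝ)
    (n : ℕ) (μ ν : Fin 4) (z : Site 4) :
    ∑ u : υ₁ ⊕ υ₂, Sum.elim R₁ R₂ u n μ ν z = ∑ u, R₁ u n μ ν z + ∑ u, R₂ u n μ ν z := by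
  simp only [Fintype.sum_sum_type, Sum.elim_inl, Sum.elim_inr]

/-- [folklore] **A GLUED FAMILY OF CONSTANTS SUMS TO THE SUM OF THE TWO** (the `hU₁` fragments add). -/
theorem sum_elim_const [Fintype υ₁] [Fintype υ₂] (C₁ : υ₁ → ℝ) (C₂ : υ₂ → ℝ) :
    ∑ u : υ₁ ⊕ υ₂, Sum.elim C₁ C₂ u = ∑ u, C₁ u + ∑ u, C₂ u := by
  simp only [Fintype.sum_sum_type, Sum.elim_inl, Sum.elim_inr]

/-- [folklore] **`hU₁` FRAGMENTS ADD**: `Σ CU′₁ ≤ U₁` and `Σ CU′₂ ≤ U₂` give `Σ_{υ₁ ⊕ υ₂} Sum.elim CU′₁ CU′₂ ≤ U₁ + U₂`. -/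
theorem hU₁_elim [Fintype υ₁] [Fintype υ₂] {C₁ : υ₁ → ℝ} {C₂ : υ₂ → ℝ} {U₁ U₂ : ℝ} (h₁ : ∑ u, C₁ u ≤ U₁) (h₂ : ∑ u, C₂ u ≤ U₂) :
    ∑ u : υ₁ ⊕ υ₂, Sum.elim C₁ C₂ u ≤ U₁ + U₂ := by
  rw [sum_elim_const]
  exact add_le_add h₁ h₂

/-! ## §2 The END's rows pass through `Sum.elim` -/

/-- [folklore] **`hMR` GLUES**: if both lanes' members have absolutely summable second moments at every one-shot scale, so does every member of the glued family. -/
theorem hMR_elim {Lc : ℕ} {μ ν : Fin 4} {R₁ : υ₁ → ℕ → Fin 4 → Fin 4 → Site 4 → ℝ} {R₂ : υ₂ → ℕ → Fin 4 → Fin 4 → Site 4 → ℝ}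
    (h₁ : ∀ (u : υ₁) (m : ℕ), 1 ≤ m → AbsMoment₂ (R₁ u (Lc ^ m) μ ν)) (h₂ : ∀ (u : υ₂) (m : ℕ), 1 ≤ m → AbsMoment₂ (R₂ u (Lc ^ m) μ ν)) :
    ∀ (u : υ₁ ⊕ υ₂) (m : ℕ), 1 ≤ m → AbsMoment₂ (Sum.elim R₁ R₂ u (Lc ^ m) μ ν) := by
  rintro (u | u) m hm
  · exact h₁ u m hm
  · exact h₂ u m hm

/-- [folklore] **`hRu` GLUES** with `Ru := Sum.elim Ru₁ Ru₂`, `CU′ := Sum.elim CU′₁ CU′₂`. -/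
theorem hRu_elim {Lc : ℕ} {μ ν : Fin 4} {R₁ : υ₁ → ℕ → Fin 4 → Fin 4 → Site 4 → ℝ} {R₂ : υ₂ → ℕ → Fin 4 → Fin 4 → Site 4 → ℝ}
    {Ru₁ : υ₁ → ℕ → ℝ} {Ru₂ : υ₂ → ℕ → ℝ} {CU'₁ : υ₁ → ℝ} {CU'₂ : υ₂ → ℝ}
    (h₁ : ∀ (u : υ₁) (m : ℕ), 1 ≤ m → |B12Beta.secondMoment (R₁ u (Lc ^ m)) μ ν - Ru₁ u (Lc ^ m)| ≤ CU'₁ u)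
    (h₂ : ∀ (u : υ₂) (m : ℕ), 1 ≤ m → |B12Beta.secondMoment (R₂ u (Lc ^ m)) μ ν - Ru₂ u (Lc ^ m)| ≤ CU'₂ u) :
    ∀ (u : υ₁ ⊕ υ₂) (m : ℕ), 1 ≤ m →
      |B12Beta.secondMoment (Sum.elim R₁ R₂ u (Lc ^ m)) μ ν - Sum.elim Ru₁ Ru₂ u (Lc ^ m)| ≤ Sum.elim CU'₁ CU'₂ u := by
  rintro (u | u) m hm
  · exact h₁ u m hm
  · exact h₂ u m hm

/-- [folklore] **`hU` GLUES** with `Ru := Sum.elim Ru₁ Ru₂`, `CU := Sum.elim CU₁ CU₂`. -/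
theorem hU_elim {Ru₁ : υ₁ → ℕ → ℝ} {Ru₂ : υ₂ → ℕ → ℝ} {CU₁ : υ₁ → ℝ} {CU₂ : υ₂ → ℝ}
    (h₁ : ∀ n : ℕ, 2 ≤ n → ∀ u : υ₁, |Ru₁ u n| ≤ CU₁ u) (h₂ : ∀ n : ℕ, 2 ≤ n → ∀ u : υ₂, |Ru₂ u n| ≤ CU₂ u) :
    ∀ n : ℕ, 2 ≤ n → ∀ u : υ₁ ⊕ υ₂, |Sum.elim Ru₁ Ru₂ u n| ≤ Sum.elim CU₁ CU₂ u := by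
  rintro n hn (u | u)
  · exact h₁ n hn u
  · exact h₂ n hn u

/-- [folklore] **THE n-UNIFORM UNIT ROW GLUES** (`|secondMoment (Rk u n) μ ν| ≤ CU u` at every `n ≥ 1`). -/
theorem unit_row_elim {μ ν : Fin 4} {R₁ : υ₁ → ℕ → Fin 4 → Fin 4 → Site 4 → ℝ} {R₂ : υ₂ → ℕ → Fin 4 → Fin 4 → Site 4 → ℝ}
    {CU₁ : υ₁ → ℝ} {CU₂ : υ₂ → ℝ}
    (h₁ : ∀ (u : υ₁) (n : ℕ), 1 ≤ n → |B12Beta.secondMoment (R₁ u n) μ ν| ≤ CU₁ u)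
    (h₂ : ∀ (u : υ₂) (n : ℕ), 1 ≤ n → |B12Beta.secondMoment (R₂ u n) μ ν| ≤ CU₂ u) :
    ∀ (u : υ₁ ⊕ υ₂) (n : ℕ), 1 ≤ n → |B12Beta.secondMoment (Sum.elim R₁ R₂ u n) μ ν| ≤ Sum.elim CU₁ CU₂ u := by
  rintro (u | u) n hn
  · exact h₁ u n hn
  · exact h₂ u n hn

/-- [folklore] READING (b) GLUES WITH ZERO `Ru` ON BOTH SIDES: `Sum.elim (fun _ _ => 0) (fun _ _ => 0) = fun _ _ => 0` pointwise, so the glued `hRu` row of two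
reading-(b) lanes is again a reading-(b) row (`Ru := 0`). -/
theorem hRu_elim_zero {Lc : ℕ} {μ ν : Fin 4} {R₁ : υ₁ → ℕ → Fin 4 → Fin 4 → Site 4 → ℝ} {R₂ : υ₂ → ℕ → Fin 4 → Fin 4 → Site 4 → ℝ}
    {CU'₁ : υ₁ → ℝ} {CU'₂ : υ₂ → ℝ}
    (h₁ : ∀ (u : υ₁) (m : ℕ), 1 ≤ m → |B12Beta.secondMoment (R₁ u (Lc ^ m)) μ ν - (fun (_ : υ₁) (_ : ℕ) => (0 : ℝ)) u (Lc ^ m)| ≤ CU'₁ u)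
    (h₂ : ∀ (u : υ₂) (m : ℕ), 1 ≤ m → |B12Beta.secondMoment (R₂ u (Lc ^ m)) μ ν - (fun (_ : υ₂) (_ : ℕ) => (0 : ℝ)) u (Lc ^ m)| ≤ CU'₂ u) :
    ∀ (u : υ₁ ⊕ υ₂) (m : ℕ), 1 ≤ m →
      |B12Beta.secondMoment (Sum.elim R₁ R₂ u (Lc ^ m)) μ ν - (fun (_ : υ₁ ⊕ υ₂) (_ : ℕ) => (0 : ℝ)) u (Lc ^ m)| ≤ Sum.elim CU'₁ CU'₂ u := by
  rintro (u | u) m hm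
  · exact h₁ u m hm
  · exact h₂ u m hm

end Summit.QuantumFields.BalabanUV.Beta.D1BFx.RestKernelSlotGlue

end
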